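import Literature.Barriers.SmoothPoincare4.SmallExoticaFrontierOddForms
import Literature.Topology.FourManifolds.HCobordismKirbyRealisation
import HarnessLib

/-!
# Akhmedov–Park at `b₂ = 3` from the REALISATION half of Kirby's Thm. X.2 (no generation theorem)

`SmallExoticaFrontierOddForms.lean` re-threads the Akhmedov–Park fact
`akhmedovPark2010_exotic_bTwo_three`, the small-exotica barrier and Donaldson's counterexample
statement through the ODD case of Wall's Thm. 2, proved in the tree modulo Kirby's Thm. X.2
(`Literature.Topology.FourManifolds.exists_diffeomorph_freeCohomologyMap_eq_of_isometryEquiv`) and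
Thom's theorem.  Kirby's Thm. X.2 has two halves (LNM 1374, pp. 61–62): (R) the handle-slide
automorphisms `A_a`, `A'_a` and `1 ⊕ O(H)` of `Q_X ⊕ H` are realised by diffeomorphisms of
`X # S² × S²`; (G) they generate `O(Q_X ⊕ H)` (Wall 1962/1963).
`Literature/Topology/FourManifolds/HCobordismKirbyRealisation.lean` proves the odd case of Wall's
theorem from (R) alone, for forms containing a hyperbolic plane
(`Literature.Topology.FourManifolds.isHCobordant_of_equivalent_intersectionForm_of_not_isEven_of_realisedWallGenerators`).
The Akhmedov–Park form `I₊ ⊕ 2I₋` contains the hyperbolic plane `⟨e₀ + e₁, e₀ + e₂⟩`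
(`exists_hyperbolicPair_of_equivalent_stdOddFormOneTwo`), so the whole odd-form frontier rests on
(R), Thom, Freedman and the Seiberg–Witten leaf — no generation theorem for orthogonal groups:

* `nonempty_homeomorph_of_equivalent_stdOddFormOneTwo_of_realisedWallGenerators_of_thom` — step (c);
* `akhmedovPark2010_exotic_bTwo_three_of_realisedWallGenerators_of_thom_of_freedman` — the target;
* `smallExoticaBarrier_of_realisedWallGenerators_of_thom_of_freedman_of_lemma8` — the barrier;
* `exists_isHCobordant_isEmpty_diffeomorph_four_of_realisedWallGenerators_of_thom_of_lemma8`,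
  `hCobordismBarrierFour_of_realisedWallGenerators_of_thom_of_lemma8` — Donaldson's counterexample
  statement and the h-cobordism barrier, without Freedman.

The realisation hypothesis `hR` is the one of `HCobordismKirbyRealisation.lean` (Kirby p. 61; it
follows from Thm. X.2, `Literature.Topology.FourManifolds.realisedWallGenerators_of_thmX2`).
Everything is proved; no named fact is introduced.

## References

* [AkhmedovPark2010] A. Akhmedov, B. D. Park, *Exotic smooth structures on small 4-manifolds with
  odd signatures*, Invent. Math. 181 (2010), Thm. 1 (i), Lemma 8 and its proof (step (c)).
* [WallJLMS1964] C. T. C. Wall, *On simply-connected 4-manifolds*, J. London Math. Soc. 39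
  (1964), Thm. 2.
* [Kirby1989] R. C. Kirby, *The topology of 4-manifolds*, LNM 1374 (1989), Ch. X, proof of
  Thm. 1 (pp. 55–56) and of Thm. 2 (pp. 61–62).
* [FreedmanJDG1982] M. H. Freedman, *The topology of four-dimensional manifolds*, J. Differential
  Geom. 17 (1982), Thm. 1.3.
-/

noncomputable section

open scoped Manifold ContDiff
open CategoryTheory LinearMap.BilinForm
open LinearMap (BilinForm)
open Literature.Topology.FourManifolds Literature.AlgebraicTopology.SingularHomology

namespace Literature.Barriers.SmoothPoincare4

/-- Local notation: `𝔼 n` is the model Euclidean space `EuclideanSpace ℝ (Fin n)`. -/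
local notation "𝔼 " n:arg => EuclideanSpace ℝ (Fin n)

/-- Local notation: `𝕊 n` is the unit sphere in `EuclideanSpace ℝ (Fin (n + 1))`. -/
local notation "𝕊 " n:arg => (Metric.sphere (0 : EuclideanSpace ℝ (Fin (n + 1))) 1)

/-- Local notation: `Q⟦μ⟧` is the intersection form on `H²(M; ℤ)/T` of the closed `ℤ`-oriented
topological 4-manifold `(M, μ)` (as in `SmallExoticaFrontierProofs.lean`). -/
local notation "Q⟦" μ "⟧" =>
  Literature.AlgebraicTopology.SingularHomology.intersectionForm two_add_two_eq_four μ

/-! ### The hyperbolic plane of `I₊ ⊕ 2I₋` -/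

/-- **`I₊ ⊕ 2I₋` contains a hyperbolic plane**: `e = e₀ + e₁`, `f = e₀ + e₂` have
`e·e = 1 - 1 = 0`, `f·f = 1 - 1 = 0`, `e·f = 1`. [cite: Serre1973, Ch. V §1.4.1] -/
theorem stdOddFormOneTwo_hyperbolicPair :
    stdOddFormOneTwo (Pi.single 0 1 + Pi.single 1 1) (Pi.single 0 1 + Pi.single 1 1) = 0 ∧
      stdOddFormOneTwo (Pi.single 0 1 + Pi.single 2 1) (Pi.single 0 1 + Pi.single 2 1) = 0 ∧
        stdOddFormOneTwo (Pi.single 0 1 + Pi.single 1 1) (Pi.single 0 1 + Pi.single 2 1) = 1 := by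
  refine ⟨?_, ?_, ?_⟩ <;>
    simp [map_add, LinearMap.add_apply, stdOddFormOneTwo_single, Matrix.diagonal]

/-- **A form isometric to `I₊ ⊕ 2I₋` contains a hyperbolic pair** (the pair of
`stdOddFormOneTwo_hyperbolicPair` carried back along the isometry). [cite: Serre1973, Ch. V §1.4.1] -/
theorem exists_hyperbolicPair_of_equivalent_stdOddFormOneTwo {M : Type*} [TopologicalSpace M]
    (μ : HomologicalOrientation ℤ M 4) (h : (Q⟦μ⟧).Equivalent stdOddFormOneTwo) :
    ∃ e f : ↥(freeCohomology ℤ M 2), Q⟦μ⟧ e e = 0 ∧ Q⟦μ⟧ f f = 0 ∧ Q⟦μ⟧ e f = 1 := by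
  obtain ⟨ψ⟩ := h
  obtain ⟨hee, hff, hef⟩ := stdOddFormOneTwo_hyperbolicPair
  refine ⟨ψ.symm (Pi.single 0 1 + Pi.single 1 1), ψ.symm (Pi.single 0 1 + Pi.single 2 1),
    ?_, ?_, ?_⟩
  · rw [ψ.symm.map_app, hee]
  · rw [ψ.symm.map_app, hff]
  · rw [ψ.symm.map_app, hef]

/-! ### Step (c) and the assembly, from (R), Thom and Freedman -/

/-- **Step (c) of Akhmedov–Park's proof of Lemma 8 through the odd case of Wall's Thm. 2, from the
realisation half (R) of Kirby's Thm. X.2** (`hR`, the hypothesis of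
`Literature.Topology.FourManifolds.isHCobordant_of_equivalent_intersectionForm_of_not_isEven_of_realisedWallGenerators`;
Kirby p. 61), Thom's theorem (`h2`) and Freedman's h-cobordism theorem (`hF`): two simply
connected closed smooth 4-manifolds whose forms are isometric to `I₊ ⊕ 2I₋` are homeomorphic —
the forms are isometric to each other, odd, and contain a hyperbolic plane
(`exists_hyperbolicPair_of_equivalent_stdOddFormOneTwo`). [cite: AkhmedovPark2010, proof of Lemma 8]
[cite: WallJLMS1964, Thm. 2] [cite: Kirby1989, Ch. X, proof of Thm. 1 (pp. 55–56) and of Thm. 2 (p. 61)]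
[cite: FreedmanJDG1982, Thm. 1.3] -/
theorem nonempty_homeomorph_of_equivalent_stdOddFormOneTwo_of_realisedWallGenerators_of_thom
    (hR : ∀ (X : Type) [TopologicalSpace X] [T2Space X] [SecondCountableTopology X]
      [ChartedSpace (𝔼 4) X] [CompactSpace X] [IsManifold (𝓡 4) ∞ X] [SimplyConnectedSpace X]
      (ξ : HomologicalOrientation ℤ X 4)
      (_hX : (Q⟦ξ⟧).IsIndefinite ∨ Module.finrank ℤ ↥(freeCohomology ℤ X 2) ≤ 8)
      (Y : Type) [TopologicalSpace Y] [T2Space Y] [SecondCountableTopology Y]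
      [ChartedSpace (𝔼 4) Y] [CompactSpace Y] [IsManifold (𝓡 4) ∞ Y]
      (_hY : IsConnectedSum (𝓡 4) (𝓡 4) ((𝓡 2).prod (𝓡 2)) X ((𝕊 2) × (𝕊 2)) Y)
      (υ : HomologicalOrientation ℤ Y 4) (V : Type) [AddCommGroup V] (Q : BilinForm ℤ V)
      (hQ : Q.IsSymm) (_e : Q.IsometryEquiv (Q⟦ξ⟧))
      (_Θ₀ : (Q.prod hyperbolicForm).IsometryEquiv (Q⟦υ⟧)),
      ∃ Θ : (Q.prod hyperbolicForm).IsometryEquiv (Q⟦υ⟧),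
        ∀ s ∈ wallGenerators hQ, IsRealisedByDiffeomorph υ (Θ.symm.trans (s.trans Θ)))
    (h2 : Literature.Topology.FourManifolds.isOrientedBordant_of_signature_eq.{0})
    (hF : Literature.Topology.FourManifolds.nonempty_homeomorph_of_isHCobordant_four.{0})
    (M N : Type) [TopologicalSpace M] [T2Space M] [SecondCountableTopology M]
    [ChartedSpace (𝔼 4) M] [IsManifold (𝓡 4) ∞ M] [CompactSpace M] [SimplyConnectedSpace M]
    [TopologicalSpace N] [T2Space N] [SecondCountableTopology N] [ChartedSpace (𝔼 4) N]
    [IsManifold (𝓡 4) ∞ N] [CompactSpace N] [SimplyConnectedSpace N]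
    (μ : HomologicalOrientation ℤ M 4) (ν : HomologicalOrientation ℤ N 4)
    (hμ : (Q⟦μ⟧).Equivalent stdOddFormOneTwo) (hν : (Q⟦ν⟧).Equivalent stdOddFormOneTwo) :
    Nonempty (M ≃ₜ N) :=
  hF (isHCobordant_of_equivalent_intersectionForm_of_not_isEven_of_realisedWallGenerators hR h2 μ ν
    (hμ.trans hν.symm) (isOdd_intersectionForm_of_equivalent_stdOddFormOneTwo μ hμ)
    (exists_hyperbolicPair_of_equivalent_stdOddFormOneTwo μ hμ))

/-- **Akhmedov–Park 2010, Thm. 1 (i), `m = 2` (`akhmedovPark2010_exotic_bTwo_three`) from the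
realisation half (R) of Kirby's Thm. X.2, Thom's theorem, Freedman's h-cobordism theorem and the
Seiberg–Witten leaf** — as `akhmedovPark2010_exotic_bTwo_three_of_thmX2_of_thom_of_freedman` with
step (c) through `hR`. [cite: AkhmedovPark2010, Thm. 1 (i) and Lemma 8] -/
theorem akhmedovPark2010_exotic_bTwo_three_of_realisedWallGenerators_of_thom_of_freedman
    (hR : ∀ (X : Type) [TopologicalSpace X] [T2Space X] [SecondCountableTopology X]
      [ChartedSpace (𝔼 4) X] [CompactSpace X] [IsManifold (𝓡 4) ∞ X] [SimplyConnectedSpace X]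
      (ξ : HomologicalOrientation ℤ X 4)
      (_hX : (Q⟦ξ⟧).IsIndefinite ∨ Module.finrank ℤ ↥(freeCohomology ℤ X 2) ≤ 8)
      (Y : Type) [TopologicalSpace Y] [T2Space Y] [SecondCountableTopology Y]
      [ChartedSpace (𝔼 4) Y] [CompactSpace Y] [IsManifold (𝓡 4) ∞ Y]
      (_hY : IsConnectedSum (𝓡 4) (𝓡 4) ((𝓡 2).prod (𝓡 2)) X ((𝕊 2) × (𝕊 2)) Y)
      (υ : HomologicalOrientation ℤ Y 4) (V : Type) [AddCommGroup V] (Q : BilinForm ℤ V)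
      (hQ : Q.IsSymm) (_e : Q.IsometryEquiv (Q⟦ξ⟧))
      (_Θ₀ : (Q.prod hyperbolicForm).IsometryEquiv (Q⟦υ⟧)),
      ∃ Θ : (Q.prod hyperbolicForm).IsometryEquiv (Q⟦υ⟧),
        ∀ s ∈ wallGenerators hQ, IsRealisedByDiffeomorph υ (Θ.symm.trans (s.trans Θ)))
    (h2 : Literature.Topology.FourManifolds.isOrientedBordant_of_signature_eq.{0})
    (hF : Literature.Topology.FourManifolds.nonempty_homeomorph_of_isHCobordant_four.{0})
    (h8 : akhmedovPark2010_lemma8_family) : akhmedovPark2010_exotic_bTwo_three := by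
  obtain ⟨X, i₁, i₂, i₃, i₄, i₅, i₆, i₇, μ, hQ, hH, hinj⟩ := h8
  exact ⟨X 0, i₁ 0, i₂ 0, i₃ 0, i₄ 0, i₅ 0, i₆ 0, i₇ 0, X, i₁, i₂, i₃, i₄, i₅, i₆, hH 0,
    fun i => nonempty_homeomorph_of_equivalent_stdOddFormOneTwo_of_realisedWallGenerators_of_thom
      hR h2 hF (X i) (X 0) (μ i) (μ 0) (hQ i) (hQ 0), hinj⟩

/-- **The small-exotica barrier from (R), Thom's theorem, Freedman's h-cobordism theorem and the
Seiberg–Witten leaf** (through `smallExoticaBarrier_of_akhmedovPark`).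
[cite: AkhmedovPark2010, Thm. 1 (i)] -/
theorem smallExoticaBarrier_of_realisedWallGenerators_of_thom_of_freedman_of_lemma8
    (hR : ∀ (X : Type) [TopologicalSpace X] [T2Space X] [SecondCountableTopology X]
      [ChartedSpace (𝔼 4) X] [CompactSpace X] [IsManifold (𝓡 4) ∞ X] [SimplyConnectedSpace X]
      (ξ : HomologicalOrientation ℤ X 4)
      (_hX : (Q⟦ξ⟧).IsIndefinite ∨ Module.finrank ℤ ↥(freeCohomology ℤ X 2) ≤ 8)
      (Y : Type) [TopologicalSpace Y] [T2Space Y] [SecondCountableTopology Y]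
      [ChartedSpace (𝔼 4) Y] [CompactSpace Y] [IsManifold (𝓡 4) ∞ Y]
      (_hY : IsConnectedSum (𝓡 4) (𝓡 4) ((𝓡 2).prod (𝓡 2)) X ((𝕊 2) × (𝕊 2)) Y)
      (υ : HomologicalOrientation ℤ Y 4) (V : Type) [AddCommGroup V] (Q : BilinForm ℤ V)
      (hQ : Q.IsSymm) (_e : Q.IsometryEquiv (Q⟦ξ⟧))
      (_Θ₀ : (Q.prod hyperbolicForm).IsometryEquiv (Q⟦υ⟧)),
      ∃ Θ : (Q.prod hyperbolicForm).IsometryEquiv (Q⟦υ⟧),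
        ∀ s ∈ wallGenerators hQ, IsRealisedByDiffeomorph υ (Θ.symm.trans (s.trans Θ)))
    (h2 : Literature.Topology.FourManifolds.isOrientedBordant_of_signature_eq.{0})
    (hF : Literature.Topology.FourManifolds.nonempty_homeomorph_of_isHCobordant_four.{0})
    (h8 : akhmedovPark2010_lemma8_family) : SmallExoticaBarrier :=
  smallExoticaBarrier_of_akhmedovPark
    (akhmedovPark2010_exotic_bTwo_three_of_realisedWallGenerators_of_thom_of_freedman hR h2 hF h8)

/-! ### Donaldson's counterexample statement and the h-cobordism barrier, without Freedman -/

/-- **An h-cobordant, non-diffeomorphic pair of simply connected closed smooth 4-manifolds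
(`Literature.Topology.FourManifolds.exists_isHCobordant_isEmpty_diffeomorph_four`) from (R),
Thom's theorem and the Seiberg–Witten leaf alone** — as
`exists_isHCobordant_isEmpty_diffeomorph_four_of_thmX2_of_thom_of_lemma8`, the members `X 0`,
`X 1` of Akhmedov–Park's family being h-cobordant by the odd case of Wall's theorem from `hR`.
[cite: DonaldsonIrrationality1987, p. 142] [cite: AkhmedovPark2010, Lemma 8] [cite: WallJLMS1964, Thm. 2] -/
theorem exists_isHCobordant_isEmpty_diffeomorph_four_of_realisedWallGenerators_of_thom_of_lemma8
    (hR : ∀ (X : Type) [TopologicalSpace X] [T2Space X] [SecondCountableTopology X]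
      [ChartedSpace (𝔼 4) X] [CompactSpace X] [IsManifold (𝓡 4) ∞ X] [SimplyConnectedSpace X]
      (ξ : HomologicalOrientation ℤ X 4)
      (_hX : (Q⟦ξ⟧).IsIndefinite ∨ Module.finrank ℤ ↥(freeCohomology ℤ X 2) ≤ 8)
      (Y : Type) [TopologicalSpace Y] [T2Space Y] [SecondCountableTopology Y]
      [ChartedSpace (𝔼 4) Y] [CompactSpace Y] [IsManifold (𝓡 4) ∞ Y]
      (_hY : IsConnectedSum (𝓡 4) (𝓡 4) ((𝓡 2).prod (𝓡 2)) X ((𝕊 2) × (𝕊 2)) Y)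
      (υ : HomologicalOrientation ℤ Y 4) (V : Type) [AddCommGroup V] (Q : BilinForm ℤ V)
      (hQ : Q.IsSymm) (_e : Q.IsometryEquiv (Q⟦ξ⟧))
      (_Θ₀ : (Q.prod hyperbolicForm).IsometryEquiv (Q⟦υ⟧)),
      ∃ Θ : (Q.prod hyperbolicForm).IsometryEquiv (Q⟦υ⟧),
        ∀ s ∈ wallGenerators hQ, IsRealisedByDiffeomorph υ (Θ.symm.trans (s.trans Θ)))
    (h2 : Literature.Topology.FourManifolds.isOrientedBordant_of_signature_eq.{0})
    (h8 : akhmedovPark2010_lemma8_family) :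
    Literature.Topology.FourManifolds.exists_isHCobordant_isEmpty_diffeomorph_four := by
  obtain ⟨X, i₁, i₂, i₃, i₄, i₅, i₆, i₇, μ, hQ, _, hinj⟩ := h8
  refine ⟨X 0, X 1, i₁ 0, i₂ 0, i₃ 0, i₄ 0, i₅ 0, i₆ 0, i₇ 0, i₁ 1, i₂ 1, i₃ 1, i₄ 1, i₅ 1,
    i₆ 1, i₇ 1,
    isHCobordant_of_equivalent_intersectionForm_of_not_isEven_of_realisedWallGenerators
      hR h2 (μ 0) (μ 1) ((hQ 0).trans (hQ 1).symm)
      (isOdd_intersectionForm_of_equivalent_stdOddFormOneTwo (μ 0) (hQ 0))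
      (exists_hyperbolicPair_of_equivalent_stdOddFormOneTwo (μ 0) (hQ 0)),
    ⟨fun d => ?_⟩⟩
  exact absurd (hinj 0 1 ⟨d⟩) zero_ne_one

/-- **The h-cobordism barrier in dimension 4 (`HCobordismBarrierFour`) from (R), Thom's theorem and
the Seiberg–Witten leaf** (through `hCobordismBarrierFour_of_donaldson`).
[cite: DonaldsonIrrationality1987, p. 142] [cite: AkhmedovPark2010, Lemma 8] -/
theorem hCobordismBarrierFour_of_realisedWallGenerators_of_thom_of_lemma8
    (hR : ∀ (X : Type) [TopologicalSpace X] [T2Space X] [SecondCountableTopology X]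
      [ChartedSpace (𝔼 4) X] [CompactSpace X] [IsManifold (𝓡 4) ∞ X] [SimplyConnectedSpace X]
      (ξ : HomologicalOrientation ℤ X 4)
      (_hX : (Q⟦ξ⟧).IsIndefinite ∨ Module.finrank ℤ ↥(freeCohomology ℤ X 2) ≤ 8)
      (Y : Type) [TopologicalSpace Y] [T2Space Y] [SecondCountableTopology Y]
      [ChartedSpace (𝔼 4) Y] [CompactSpace Y] [IsManifold (𝓡 4) ∞ Y]
      (_hY : IsConnectedSum (𝓡 4) (𝓡 4) ((𝓡 2).prod (𝓡 2)) X ((𝕊 2) × (𝕊 2)) Y)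
      (υ : HomologicalOrientation ℤ Y 4) (V : Type) [AddCommGroup V] (Q : BilinForm ℤ V)
      (hQ : Q.IsSymm) (_e : Q.IsometryEquiv (Q⟦ξ⟧))
      (_Θ₀ : (Q.prod hyperbolicForm).IsometryEquiv (Q⟦υ⟧)),
      ∃ Θ : (Q.prod hyperbolicForm).IsometryEquiv (Q⟦υ⟧),
        ∀ s ∈ wallGenerators hQ, IsRealisedByDiffeomorph υ (Θ.symm.trans (s.trans Θ)))
    (h2 : Literature.Topology.FourManifolds.isOrientedBordant_of_signature_eq.{0})
    (h8 : akhmedovPark2010_lemma8_family) : HCobordismBarrierFour :=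
  hCobordismBarrierFour_of_donaldson
    (exists_isHCobordant_isEmpty_diffeomorph_four_of_realisedWallGenerators_of_thom_of_lemma8 hR
      h2 h8)

end Literature.Barriers.SmoothPoincare4

end
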